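import Summits.Ventures.CertifiedManyBodySolver.Downfold.EmeryBoxesYBCO7ThermalCapRetiltBoxp1
import Summits.Ventures.CertifiedManyBodySolver.Downfold.EmeryBoxesYBCO7ThermalCapWord
import Summits.Ventures.CertifiedManyBodySolver.Downfold.EmeryThermalAtomicFloor
import HarnessLib

/-!
# HIGH-TEMPERATURE-CLOSING `T > 0` WINDOW on YBa2Cu3O7 #18/M18 plane Cu(2) U-slice — `emeryBoxYBCO7planeY6K26` (router/EMERY-FLOOR-ORDERS row 42): the ATOMIC-LIMIT floor (full entropy) ∨ the
# family floor, against the re-tilted cap — both sides meet at `6 log 2` as β → 0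

Venture CertifiedManyBodySolver, cell `pub/hubbard-downfold` (S1 = ROUTER) × crew hubbard-fast S2 (ii) × (iv) «T > 0 × multi-band» (D-0096 (ii)); seat hubbard-downfold-mod-4
(S1/S2 Emery seam, g17). Namespace `Summit.Ventures.CertifiedManyBodySolver.Downfold`. DOOR: `EmeryThermalAtomicFloor` (`holdsOn_emeryCellPressureAtomicFloor`: Peierls on the
whole occupation basis of the `Cu₄O₈` block, site-wise factorisation; the one-site function is the tree's `atomicPartitionFnReal β U μ`). INPUTS BY NAME: the family floor
`emeryBoxYBCO7planeY6K26_pressureFloorFam_m46o5` (`EmeryBoxesYBCO7ThermalCapWord`; C = (-140.232528, -142.253061)), the cap `emeryBoxYBCO7planeY6K26_pressureCap_m46o5_retilt` (`EmeryBoxesYBCO7ThermalCapRetiltBoxp1`; `6 log 2 + 40.3430·β`; flat word 43.9533).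
ATOMIC DATA: Cu at `μ_d = −(εp + Δ_hi) = 158/25`, `U_d,hi = 5057/1000`; O at `μ_p = −εp = 46/5`, `U_p,hi = 2171/500` ⇒ classical slope 35.6990·β (family slope 35.5633; cap 40.3430).
RESULT: **`emeryBoxYBCO7planeY6K26_pressureWindowHighT_m46o5`**: `max(atomic, family) ≤ P_cell ≤ 6 log 2 + 40.3430·β` on the whole box, every β ≥ 0; width → 0 as β → 0 (both sides `6 log 2`,
`emeryBoxYBCO7planeY6K26_pressure_beta_zero_m46o5`); crossover β* ≈ none below which the atomic floor is the better floor [float].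

Everything PROVED (0 sorry); no definition. HONEST FRAMING: CERTIFIED inequalities on a SCREENING/EXTRAPOLATED-grade object; the atomic floor ignores hopping (its slope sits
-0.1357 below the family floor's), so at physical temperatures (β ≈ 20–40 eV⁻¹) the family floor still decides and thermal scales are NOT resolved there; what is new
is the correct INFINITE-TEMPERATURE closure of the window and a certified high-T regime (β ≲ β*) with width `≈ 4.6441·β`; grand-canonical at the stated level; no phase word;
no router number moves. WHAT-THIS-IS-NOT: a new certificate (pure algebra on landed objects; zero kit).
-/

noncomputable section

namespace Summit.Ventures.CertifiedManyBodySolver.Downfold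

open NonemptyInterval Matrix Finset Literature.Probability.LatticeModels
open Literature.MathematicalPhysics.QuantumLattice Literature.Computation.Certificates
open Summit.Ventures.CertifiedManyBodySolver.Certificates OccupationCode ClusterLowerBound
open scoped BigOperators ComplexOrder

/-! ## §1 The atomic-limit floor on the box at εp = -46/5 -/

/-- **ATOMIC-LIMIT `T > 0` FLOOR** on the whole `emeryBoxYBCO7planeY6K26`, cuprate signs, level εp = -46/5 (chemical potential 46/5 eV), EVERY β ≥ 0:
`log z₀(β; U_d = 5057/1000, μ_d = 158/25) + 2·log z₀(β; U_p = 2171/500, μ_p = 46/5) ≤ P_cell` with `z₀(β; U, μ) = 1 + 2e^{βμ} + e^{−β(U−2μ)}` (`atomicPartitionFnReal`; Cu at the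
box's upper level `εp + Δ_hi = -158/25` and `U_d,hi`, O at `εp` and `U_p,hi`). Value `6 log 2` at β = 0; slope `35.6990·β` as β → ∞ (classical minimum, no hopping).
[cite: Ruelle1969, §2.5–2.6] [cite: Ueltschi1999, §3] -/
theorem emeryBoxYBCO7planeY6K26_pressureAtomicFloor_m46o5 {β : ℝ} (hβ : 0 ≤ β) :
    HoldsOn (fun p : EmeryCoord → ℝ => Real.log (atomicPartitionFnReal β (5057/1000 : ℝ) (158/25 : ℝ)) + 2 * Real.log (atomicPartitionFnReal β (2171/500 : ℝ) (46/5 : ℝ)) ≤ emeryCellPressure β (emeryLine cuprateSigns (emeryLineCoords (((-46/5 : ℚ)) : ℝ) p))) emeryBoxYBCO7planeY6K26 := by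
  intro p hp
  have h := holdsOn_emeryCellPressureAtomicFloor (E := emeryBoxYBCO7planeY6K26) (eA := ybco7planeY6K26Emery_tpd) (eB := ybco7planeY6K26Emery_tpp) (eD := ybco7planeY6K26Emery_Delta) (eUd := ybco7planeY6K26Emery_Udd) (eUp := ybco7planeY6K26Emery_Upp) (-46/5) (by simp [emeryBoxYBCO7planeY6K26, emeryBoxYBCO7planeY6K26Src, Function.update]) (by simp [emeryBoxYBCO7planeY6K26, emeryBoxYBCO7planeY6K26Src, Function.update]) (Function.update_self _ _ _) (by simp [emeryBoxYBCO7planeY6K26, emeryBoxYBCO7planeY6K26Src, Function.update]) (by simp [emeryBoxYBCO7planeY6K26, emeryBoxYBCO7planeY6K26Src, Function.update]) cuprateSigns hβ p hp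
  simp only [ybco7planeY6K26Emery_Delta, ybco7planeY6K26Emery_Udd, ybco7planeY6K26Emery_Upp, Entry.encl_ofEnds_snd] at h
  push_cast at h
  norm_num at h ⊢
  exact h

/-! ## §2 The best floor and the HIGH-TEMPERATURE-CLOSING window -/

/-- **BEST `T > 0` FLOOR = max(atomic, family)** on the whole box at εp = -46/5, every β ≥ 0: the atomic floor (full entropy, slope 35.6990) wins for
β < β* ≈ ∞ (all T), the family floor `emeryBoxYBCO7planeY6K26_pressureFloorFam_m46o5` (slope 35.5633, entropy ¼·log 2) for β > β*. [cite: Ruelle1969, §2.5–2.6] [cite: Israel1979, Lemma II.3.1] -/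
theorem emeryBoxYBCO7planeY6K26_pressureFloorBest_m46o5 {β : ℝ} (hβ : 0 ≤ β) :
    HoldsOn (fun p : EmeryCoord → ℝ => max (Real.log (atomicPartitionFnReal β (5057/1000 : ℝ) (158/25 : ℝ)) + 2 * Real.log (atomicPartitionFnReal β (2171/500 : ℝ) (46/5 : ℝ))) (Real.log (Real.exp (-(β * (-8764533/62500 : ℝ))) + Real.exp (-(β * (-142253061/1000000 : ℝ)))) / 4) ≤ emeryCellPressure β (emeryLine cuprateSigns (emeryLineCoords (((-46/5 : ℚ)) : ℝ) p))) emeryBoxYBCO7planeY6K26 :=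
  fun p hp => max_le (emeryBoxYBCO7planeY6K26_pressureAtomicFloor_m46o5 hβ p hp) (emeryBoxYBCO7planeY6K26_pressureFloorFam_m46o5 hβ p hp)

/-- **THE HIGH-TEMPERATURE-CLOSING TWO-SIDED `T > 0` WINDOW** (hypothesis-free on both sides) on the whole `emeryBoxYBCO7planeY6K26`, level εp = -46/5, EVERY β ≥ 0:
`max(atomic, family) ≤ P_cell ≤ 6 log 2 + β·806861/20000` (cap = `emeryBoxYBCO7planeY6K26_pressureCap_m46o5_retilt`, hubbard-box-p1 re-tilted). BOTH SIDES EQUAL `6 log 2` AT β = 0; the width is `O(β)` for small β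
(slope gap 4.6441 against the atomic floor, 4.7798 against the family floor). Table [float; `T = 11604.5/β` K]:
| β (1/eV) | T (K) | atomic floor | family floor | best floor | cap | width |
|---|---|---|---|---|---|---|
| 0.01 | 1160450 | 4.3747 | 0.5264 | 4.3747 | 4.5623 | 0.1876 |
| 0.1 | 116045 | 6.5557 | 3.7056 | 6.5557 | 8.1932 | 1.6375 |
| 0.5 | 23209 | 18.9110 | 17.8593 | 18.9110 | 24.3304 | 5.4194 |
| 1 | 11604 | 36.1784 | 35.5944 | 36.1784 | 44.5019 | 8.3235 |
| 2 | 5802 | 71.5466 | 71.1309 | 71.5466 | 84.8450 | 13.2984 |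
| 5 | 2321 | 178.4986 | 177.8163 | 178.4986 | 205.8741 | 27.3755 |
| 10 | 1160 | 356.9900 | 355.6327 | 356.9900 | 407.5894 | 50.5994 |
| 20 | 580 | 713.9800 | 711.2653 | 713.9800 | 811.0199 | 97.0399 |
| 40 | 290 | 1427.9600 | 1422.5306 | 1427.9600 | 1617.8809 | 189.9209 |
[cite: Israel1979, Thm. I.2.4] [cite: Ruelle1969, §2.5–2.6] [cite: Ueltschi1999, §3] -/
theorem emeryBoxYBCO7planeY6K26_pressureWindowHighT_m46o5 {β : ℝ} (hβ : 0 ≤ β) :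
    HoldsOn (fun p : EmeryCoord → ℝ =>
      max (Real.log (atomicPartitionFnReal β (5057/1000 : ℝ) (158/25 : ℝ)) + 2 * Real.log (atomicPartitionFnReal β (2171/500 : ℝ) (46/5 : ℝ))) (Real.log (Real.exp (-(β * (-8764533/62500 : ℝ))) + Real.exp (-(β * (-142253061/1000000 : ℝ)))) / 4) ≤ emeryCellPressure β (emeryLine cuprateSigns (emeryLineCoords (((-46/5 : ℚ)) : ℝ) p)) ∧
      emeryCellPressure β (emeryLine cuprateSigns (emeryLineCoords (((-46/5 : ℚ)) : ℝ) p)) ≤ 6 * Real.log 2 + β * (806861/20000 : ℝ)) emeryBoxYBCO7planeY6K26 :=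
  fun p hp => ⟨emeryBoxYBCO7planeY6K26_pressureFloorBest_m46o5 hβ p hp, by simpa using emeryBoxYBCO7planeY6K26_pressureCap_m46o5_retilt hβ p hp⟩

/-- **At β = 0 the window is a point**: `P_cell(0, ·) = 6 log 2` on the whole box (floor and cap coincide). [cite: Ueltschi1999, §3] -/
theorem emeryBoxYBCO7planeY6K26_pressure_beta_zero_m46o5 :
    HoldsOn (fun p : EmeryCoord → ℝ => emeryCellPressure 0 (emeryLine cuprateSigns (emeryLineCoords (((-46/5 : ℚ)) : ℝ) p)) = 6 * Real.log 2) emeryBoxYBCO7planeY6K26 := by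
  intro p hp
  have h := emeryBoxYBCO7planeY6K26_pressureWindowHighT_m46o5 le_rfl p hp
  rw [atomicPartitionFnReal_beta_zero, atomicPartitionFnReal_beta_zero, show (4 : ℝ) = 2 ^ 2 by norm_num, Real.log_pow] at h
  push_cast at h
  have h1 := (le_max_left _ _).trans h.1
  linarith [h.2]

end Summit.Ventures.CertifiedManyBodySolver.Downfold

end
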